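import Summits.QuantumFields.YangMills.Theorems.ColdStartUniversalityLatticeLangevinWilsonSpectralGapMeasurable
import Literature.Analysis.Convex.ChordPointConvexityCriterion
import HarnessLib

/-!
# Route `ColdStartUniversality` (fixed-cut-off `L²(μ_{β'})` package): CONVEXITY of `u ↦ ⟨G, κ_u G⟩_{μ_{β'}}` for the reversible
# SZZ dynamics, the semigroup Dirichlet forms `𝓔_h`, and a discrete Grönwall lemma for convex functions

Helper file (seat `ym-line-csu-p1`, g17; `--supports stmt-QuantumFields-27363`), first half of the SEMIGROUP-FORM POINCARÉ package
(sequel: `…WilsonSemigroupPoincare`).  For the SU(2) lattice Langevin dynamics of Shen–Zhu–Zhu at any `L, β'`, reversible w.r.t. the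
Wilson measure `μ = μ_{β'}` (`integral_mul_transition_symm_su2`), and a continuous observable `G`, put `Φ_G(u) := ∫ G · κ_u G dμ` and,
for `h > 0`, `𝓔_h(G) := h⁻¹(∫ G² dμ − ∫ G κ_h G dμ) = h⁻¹(Φ_G(0) − Φ_G(h))` — the DIRICHLET FORM OF THE SEMIGROUP AT SCALE `h`.

* §1 `mul_one_add_le_of_convexOn_of_step`, ★ `le_exp_neg_mul_of_convexOn_of_forall_step` — DISCRETE GRÖNWALL FOR CONVEX FUNCTIONS:
  a convex `φ` on `[0, ∞)` whose forward secant slope at every `b` satisfies `a φ(b) ≤ (φ(b) − φ(b+h))/h` for SOME `h = h(b) > 0`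
  obeys `φ(u) ≤ e^{−au} φ(0)` (secant monotonicity `φ(b)(1 + as) ≤ φ(b − s)`, `n` steps, `(1 + au/n)^n → e^{au}`).  This replaces
  the differential inequality `Λ' = −2𝓔(P_t f) ≤ −2Λ/C` in Bakry–Gentil–Ledoux's proof of Thm 4.2.5 (heat equation on a core).
* §2 `integral_transition_mul_transition_eq` (`∫ κ_sG · κ_tG dμ = Φ_G(s+t)`: Chapman–Kolmogorov + reversibility),
  ★ `two_mul_integral_mul_transition_add_le` (MIDPOINT CONVEXITY `2Φ_G(s+t) ≤ Φ_G(2s) + Φ_G(2t)`, i.e. `‖κ_sG − κ_tG‖²_{L²(μ)} ≥ 0`),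
  `continuous_integral_mul_transition` (joint continuity of the kernel action), ★ `convexOn_integral_mul_transition` (`Φ_G` is
  CONVEX on `[0,∞)`: Hardy–Littlewood–Pólya Thm 86), `dirichletScale_transition_le` (`𝓔_h(κ_s G) ≤ 𝓔_h(G)`: the form contracts
  along the semigroup) and `dirichletScale_antitone` (`𝓔_{h'}(G) ≤ 𝓔_h(G)` for `h ≤ h'`, so `𝓔(G) := lim_{h↓0} 𝓔_h(G) = sup_h 𝓔_h(G)`
  exists in `[0, ∞]` for every continuous `G`).

THEOREMS ONLY, no definition, no sorry.  HONEST FRAMING: RECORD-rung R3 plumbing at FIXED cut-off (entrance to the `hEquiv`-free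
Poincaré ⇔ decay equivalence of the sequel); nothing K-uniform is proved; no crux, rung or summit statement is proved; the Yang–Mills
mass gap is NOT proved.
-/

set_option autoImplicit false

noncomputable section

namespace Summit.QuantumFields.YangMills.Theorems.ColdStartUniversality

open MeasureTheory ProbabilityTheory Filter Set Topology
open scoped BigOperators NNReal ENNReal
open Literature.Probability.Process Literature.MathematicalPhysics.QuantumFieldTheory
open Literature.MathematicalPhysics.QuantumLattice (fundamentalRep fundamentalLatticeRep continuous_fundamentalRep)

/-! ## §1. A discrete Grönwall lemma for convex functions -/

/-- **Backward step from a forward slope bound.**  For `φ` convex on `[0, ∞)`: if the forward secant slope of `φ` at `b` over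
SOME `[b, b+h]` is at most `−a φ(b)`, then `φ(b)(1 + a s) ≤ φ(b − s)` for every `0 < s ≤ b` (secant slopes of a convex function
increase: `(φ(b) − φ(b−s))/s ≤ (φ(b+h) − φ(b))/h`). [cite: HardyLittlewoodPolya1952, §3.18 (111)] -/
theorem mul_one_add_le_of_convexOn_of_step {φ : ℝ → ℝ} (hφ : ConvexOn ℝ (Ici 0) φ) {a b h : ℝ} (hh : 0 < h)
    (hst : a * φ b ≤ (φ b - φ (b + h)) / h) {s : ℝ} (hs : 0 < s) (hsb : s ≤ b) :
    φ b * (1 + a * s) ≤ φ (b - s) := by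
  have hslope := hφ.slope_mono_adjacent (x := b - s) (y := b) (z := b + h)
    (by simp only [mem_Ici]; linarith) (by simp only [mem_Ici]; linarith) (by linarith) (by linarith)
  have e1 : b - (b - s) = s := by ring
  have e2 : b + h - b = h := by ring
  rw [e1, e2] at hslope
  have h2 : (φ (b + h) - φ b) / h ≤ -(a * φ b) := by
    have e : (φ b - φ (b + h)) / h = -((φ (b + h) - φ b) / h) := by ring
    linarith [hst]
  have h3 : (φ b - φ (b - s)) / s ≤ -(a * φ b) := hslope.trans h2
  rw [div_le_iff₀ hs] at h3
  nlinarith [h3]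

/-- **Discrete Grönwall for convex functions.**  Let `φ` be convex on `[0, ∞)` and `a > 0`.  If at every `b ≥ 0` some forward
secant slope satisfies `a φ(b) ≤ (φ(b) − φ(b+h))/h` (`h = h(b) > 0`), then `φ(u) ≤ e^{−au} φ(0)` for all `u ≥ 0`: iterate
`mul_one_add_le_of_convexOn_of_step` along `u/n, 2u/n, …, u` to get `φ(u)(1 + au/n)^n ≤ φ(0)` and let `n → ∞`.  (This replaces the
differential inequality `Λ' ≤ −2Λ/C` of Bakry–Gentil–Ledoux's proof of Thm 4.2.5, which needs the heat equation on a core.)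
[cite: BakryGentilLedoux2014, Thm 4.2.5 (proof, (4.2.2))] -/
theorem le_exp_neg_mul_of_convexOn_of_forall_step {φ : ℝ → ℝ} (hφ : ConvexOn ℝ (Ici 0) φ) {a : ℝ} (ha : 0 < a)
    (hstep : ∀ b : ℝ, 0 ≤ b → ∃ h : ℝ, 0 < h ∧ a * φ b ≤ (φ b - φ (b + h)) / h) {u : ℝ} (hu : 0 ≤ u) :
    φ u ≤ Real.exp (-(a * u)) * φ 0 := by
  -- `n` backward steps of size `u / n`
  have hiter : ∀ n : ℕ, 0 < n → φ u * (1 + a * (u / n)) ^ n ≤ φ 0 := by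
    intro n hn
    rcases hu.eq_or_lt with hu0 | hupos
    · rw [← hu0]; simp
    have hs : 0 < u / n := div_pos hupos (Nat.cast_pos.2 hn)
    have h1as : 0 ≤ 1 + a * (u / n) := by positivity
    have key : ∀ k : ℕ, φ ((k : ℝ) * (u / n)) * (1 + a * (u / n)) ^ k ≤ φ 0 := by
      intro k
      induction k with
      | zero => simp
      | succ k ih =>
        obtain ⟨h, hh, hst⟩ := hstep (((k + 1 : ℕ) : ℝ) * (u / n)) (by positivity)
        have hb := mul_one_add_le_of_convexOn_of_step hφ hh hst hs
          (by rw [Nat.cast_succ]; nlinarith [hs.le, (Nat.cast_nonneg k : (0 : ℝ) ≤ k)])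
        have e : (((k + 1 : ℕ) : ℝ)) * (u / n) - u / n = (k : ℝ) * (u / n) := by push_cast; ring
        rw [e] at hb
        calc φ (((k + 1 : ℕ) : ℝ) * (u / n)) * (1 + a * (u / n)) ^ (k + 1)
            = (φ (((k + 1 : ℕ) : ℝ) * (u / n)) * (1 + a * (u / n))) * (1 + a * (u / n)) ^ k := by
              rw [pow_succ]; ring
          _ ≤ φ ((k : ℝ) * (u / n)) * (1 + a * (u / n)) ^ k :=
              mul_le_mul_of_nonneg_right hb (pow_nonneg h1as _)
          _ ≤ φ 0 := ih
    have h := key n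
    have e : (n : ℝ) * (u / n) = u := by field_simp
    rwa [e] at h
  -- the limit `(1 + au/n)^n → e^{au}`
  have hlim : Tendsto (fun n : ℕ => φ u * (1 + a * (u / n)) ^ n) atTop (𝓝 (φ u * Real.exp (a * u))) := by
    have h1 := (Real.tendsto_one_add_div_pow_exp (a * u)).const_mul (φ u)
    refine h1.congr' ?_
    filter_upwards [eventually_gt_atTop 0] with n hn
    have e : a * u / (n : ℝ) = a * (u / n) := by ring
    rw [e]
  have hle : φ u * Real.exp (a * u) ≤ φ 0 :=
    le_of_tendsto hlim (by filter_upwards [eventually_gt_atTop 0] with n hn using hiter n hn)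
  have hpos : 0 < Real.exp (a * u) := Real.exp_pos _
  rw [Real.exp_neg]
  calc φ u = (φ u * Real.exp (a * u)) * (Real.exp (a * u))⁻¹ := by field_simp
    _ ≤ φ 0 * (Real.exp (a * u))⁻¹ := mul_le_mul_of_nonneg_right hle (inv_nonneg.2 hpos.le)
    _ = (Real.exp (a * u))⁻¹ * φ 0 := mul_comm _ _

/-! ## §2. The quadratic form `u ↦ ∫ G · κ_u G dμ_{β'}` -/

variable {L : ℕ} [NeZero L]

/-- **`∫ κ_s F · κ_t F dμ_{β'} = ∫ F · κ_{s+t} F dμ_{β'}`** for continuous `F` (Chapman–Kolmogorov `κ_{s+t} = κ_s κ_t` and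
reversibility `∫ F κ_s(κ_t F) dμ = ∫ κ_t F · κ_s F dμ`). [cite: ShenZhuZhu2022, §3 (p. 13)] -/
theorem integral_transition_mul_transition_eq (L : ℕ) [NeZero L] (β' : ℝ)
    (κ : ℝ≥0 → Kernel (GaugeConfig 3 L (Matrix.specialUnitaryGroup (Fin 2) ℂ))
      (GaugeConfig 3 L (Matrix.specialUnitaryGroup (Fin 2) ℂ))) [∀ t, IsMarkovKernel (κ t)]
    (hreal : ∀ (t : ℝ≥0) (x : GaugeConfig 3 L (Matrix.specialUnitaryGroup (Fin 2) ℂ))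
        (Ω : Type) [MeasurableSpace Ω] (P : Measure Ω) [IsProbabilityMeasure P]
        (W : ℝ≥0 → Ω → (Edge 3 L × NoiseIdx 2 → ℝ)) (hW : IsFlatBrownian W P)
        (U : ℝ≥0 → Ω → GaugeConfig 3 L (Matrix.specialUnitaryGroup (Fin 2) ℂ)),
        (∀ ω, U 0 ω = x) →
        (latticeLangevinDynamics (fundamentalLatticeRep 2) β').IsSolution (fundamentalRep (Fin 2))
          hW.natFiltration P W U →
        κ t x = P.map (U t))
    (s t : ℝ≥0) {F : GaugeConfig 3 L (Matrix.specialUnitaryGroup (Fin 2) ℂ) → ℝ} (hF : Continuous F) :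
    ∫ x, (∫ y, F y ∂(κ s x)) * (∫ y, F y ∂(κ t x)) ∂(wilsonMeasure (d := 3) (L := L) (fundamentalRep (Fin 2)) β') =
      ∫ x, F x * (∫ y, F y ∂(κ (s + t) x)) ∂(wilsonMeasure (d := 3) (L := L) (fundamentalRep (Fin 2)) β') := by
  classical
  haveI := secondCountableTopology_su2
  haveI := borelSpace_config L
  obtain ⟨M, hM0, hM⟩ := exists_abs_le_of_continuous hF
  have hFi : ∀ (ν : Measure (GaugeConfig 3 L (Matrix.specialUnitaryGroup (Fin 2) ℂ))) [IsProbabilityMeasure ν],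
      Integrable F ν := fun ν _ =>
    Integrable.of_bound hF.aestronglyMeasurable M (Eventually.of_forall fun z => by rw [Real.norm_eq_abs]; exact hM z)
  have hAt : Continuous fun y => ∫ z, F z ∂(κ t y) := continuous_integral_transitionKernel L β' κ hreal t hF
  have hCK : κ (s + t) = κ t ∘ₖ κ s := chapmanKolmogorov_szz β' κ hreal s t
  have e1 : ∀ x, ∫ y, F y ∂(κ (s + t) x) = ∫ y, (∫ z, F z ∂(κ t y)) ∂(κ s x) := by
    intro x
    haveI : IsProbabilityMeasure ((κ t ∘ₖ κ s) x) := by rw [← hCK]; infer_instance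
    rw [hCK]
    exact Kernel.integral_comp (hFi _)
  simp_rw [e1]
  rw [integral_mul_transition_symm_su2 L β' κ hreal s hF hAt]
  exact integral_congr_ae (Eventually.of_forall fun x => by dsimp only; rw [mul_comm])

/-- ★ **Midpoint convexity of `u ↦ ∫ G · κ_u G dμ_{β'}`**: `2 ∫ G κ_{s+t} G dμ ≤ ∫ G κ_{2s} G dμ + ∫ G κ_{2t} G dμ`, i.e.
`‖κ_s G − κ_t G‖²_{L²(μ)} ≥ 0` after `integral_transition_mul_transition_eq`.  (Bakry–Gentil–Ledoux Lemma 4.2.6 prove the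
stronger LOG-convexity via the generator; g15's `sq_integral_mul_transition_le` is its dyadic form; plain convexity is what
the decay theorem below consumes.) [cite: BakryGentilLedoux2014, Lemma 4.2.6] -/
theorem two_mul_integral_mul_transition_add_le (L : ℕ) [NeZero L] (β' : ℝ)
    (κ : ℝ≥0 → Kernel (GaugeConfig 3 L (Matrix.specialUnitaryGroup (Fin 2) ℂ))
      (GaugeConfig 3 L (Matrix.specialUnitaryGroup (Fin 2) ℂ))) [∀ t, IsMarkovKernel (κ t)]
    (hreal : ∀ (t : ℝ≥0) (x : GaugeConfig 3 L (Matrix.specialUnitaryGroup (Fin 2) ℂ))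
        (Ω : Type) [MeasurableSpace Ω] (P : Measure Ω) [IsProbabilityMeasure P]
        (W : ℝ≥0 → Ω → (Edge 3 L × NoiseIdx 2 → ℝ)) (hW : IsFlatBrownian W P)
        (U : ℝ≥0 → Ω → GaugeConfig 3 L (Matrix.specialUnitaryGroup (Fin 2) ℂ)),
        (∀ ω, U 0 ω = x) →
        (latticeLangevinDynamics (fundamentalLatticeRep 2) β').IsSolution (fundamentalRep (Fin 2))
          hW.natFiltration P W U →
        κ t x = P.map (U t))
    (s t : ℝ≥0) {F : GaugeConfig 3 L (Matrix.specialUnitaryGroup (Fin 2) ℂ) → ℝ} (hF : Continuous F) :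
    2 * ∫ x, F x * (∫ y, F y ∂(κ (s + t) x)) ∂(wilsonMeasure (d := 3) (L := L) (fundamentalRep (Fin 2)) β') ≤
      (∫ x, F x * (∫ y, F y ∂(κ (s + s) x)) ∂(wilsonMeasure (d := 3) (L := L) (fundamentalRep (Fin 2)) β')) +
        ∫ x, F x * (∫ y, F y ∂(κ (t + t) x)) ∂(wilsonMeasure (d := 3) (L := L) (fundamentalRep (Fin 2)) β') := by
  classical
  haveI := secondCountableTopology_su2
  haveI := borelSpace_config L
  set μ : Measure (GaugeConfig 3 L (Matrix.specialUnitaryGroup (Fin 2) ℂ)) :=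
    wilsonMeasure (d := 3) (L := L) (fundamentalRep (Fin 2)) β' with hμ
  haveI : IsProbabilityMeasure μ :=
    isProbabilityMeasure_wilsonMeasure (d := 3) (L := L) (fundamentalRep (Fin 2)) (continuous_fundamentalRep (Fin 2)) β'
  have hAs : Continuous fun y => ∫ z, F z ∂(κ s y) := continuous_integral_transitionKernel L β' κ hreal s hF
  have hAt : Continuous fun y => ∫ z, F z ∂(κ t y) := continuous_integral_transitionKernel L β' κ hreal t hF
  rw [← integral_transition_mul_transition_eq L β' κ hreal s t hF, integral_mul_transition_self_eq_sq L β' κ hreal s hF,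
    integral_mul_transition_self_eq_sq L β' κ hreal t hF]
  have hi1 : Integrable (fun x => (∫ z, F z ∂(κ s x)) ^ 2) μ :=
    integrable_of_continuous_of_compactSpace (hAs.pow 2) μ
  have hi2 : Integrable (fun x => (∫ z, F z ∂(κ t x)) ^ 2) μ :=
    integrable_of_continuous_of_compactSpace (hAt.pow 2) μ
  have hi3 : Integrable (fun x => (∫ z, F z ∂(κ s x)) * (∫ z, F z ∂(κ t x))) μ :=
    integrable_of_continuous_of_compactSpace (hAs.mul hAt) μ
  have hi12 : Integrable (fun x => (∫ z, F z ∂(κ s x)) ^ 2 + (∫ z, F z ∂(κ t x)) ^ 2) μ := hi1.add hi2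
  have hi3' : Integrable (fun x => 2 * ((∫ z, F z ∂(κ s x)) * (∫ z, F z ∂(κ t x)))) μ := hi3.const_mul 2
  have h0 : 0 ≤ ∫ x, ((∫ z, F z ∂(κ s x)) - ∫ z, F z ∂(κ t x)) ^ 2 ∂μ := integral_nonneg fun x => sq_nonneg _
  have hexp : ∫ x, ((∫ z, F z ∂(κ s x)) - ∫ z, F z ∂(κ t x)) ^ 2 ∂μ =
      (∫ x, (∫ z, F z ∂(κ s x)) ^ 2 ∂μ) + (∫ x, (∫ z, F z ∂(κ t x)) ^ 2 ∂μ) -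
        2 * ∫ x, (∫ z, F z ∂(κ s x)) * (∫ z, F z ∂(κ t x)) ∂μ := by
    have e : (fun x => ((∫ z, F z ∂(κ s x)) - ∫ z, F z ∂(κ t x)) ^ 2) =
        fun x => ((∫ z, F z ∂(κ s x)) ^ 2 + (∫ z, F z ∂(κ t x)) ^ 2) -
          2 * ((∫ z, F z ∂(κ s x)) * (∫ z, F z ∂(κ t x))) := by
      funext x; ring
    rw [e, integral_sub hi12 hi3', integral_add hi1 hi2, integral_const_mul]
  linarith

/-- **Continuity of `u ↦ ∫ F · κ_u G dμ_{β'}`** for continuous `F, G` (joint continuity of the kernel action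
`continuous_transitionKernel_action` on the compact configuration space, dominated convergence). [folklore] -/
theorem continuous_integral_mul_transition (L : ℕ) [NeZero L] (β' : ℝ)
    (κ : ℝ≥0 → Kernel (GaugeConfig 3 L (Matrix.specialUnitaryGroup (Fin 2) ℂ))
      (GaugeConfig 3 L (Matrix.specialUnitaryGroup (Fin 2) ℂ))) [∀ t, IsMarkovKernel (κ t)]
    (hreal : ∀ (t : ℝ≥0) (x : GaugeConfig 3 L (Matrix.specialUnitaryGroup (Fin 2) ℂ))
        (Ω : Type) [MeasurableSpace Ω] (P : Measure Ω) [IsProbabilityMeasure P]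
        (W : ℝ≥0 → Ω → (Edge 3 L × NoiseIdx 2 → ℝ)) (hW : IsFlatBrownian W P)
        (U : ℝ≥0 → Ω → GaugeConfig 3 L (Matrix.specialUnitaryGroup (Fin 2) ℂ)),
        (∀ ω, U 0 ω = x) →
        (latticeLangevinDynamics (fundamentalLatticeRep 2) β').IsSolution (fundamentalRep (Fin 2))
          hW.natFiltration P W U →
        κ t x = P.map (U t))
    {F G : GaugeConfig 3 L (Matrix.specialUnitaryGroup (Fin 2) ℂ) → ℝ} (hF : Continuous F) (hG : Continuous G) :
    Continuous fun u : ℝ≥0 =>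
      ∫ x, F x * (∫ y, G y ∂(κ u x)) ∂(wilsonMeasure (d := 3) (L := L) (fundamentalRep (Fin 2)) β') := by
  classical
  haveI := secondCountableTopology_su2
  haveI := borelSpace_config L
  set μ : Measure (GaugeConfig 3 L (Matrix.specialUnitaryGroup (Fin 2) ℂ)) :=
    wilsonMeasure (d := 3) (L := L) (fundamentalRep (Fin 2)) β' with hμ
  haveI : IsProbabilityMeasure μ :=
    isProbabilityMeasure_wilsonMeasure (d := 3) (L := L) (fundamentalRep (Fin 2)) (continuous_fundamentalRep (Fin 2)) β'
  have hact := continuous_transitionKernel_action (L := L) β' κ hreal hG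
  have hunc : Continuous (Function.uncurry fun (u : ℝ≥0) (x : GaugeConfig 3 L (Matrix.specialUnitaryGroup (Fin 2) ℂ)) =>
      F x * (∫ y, G y ∂(κ u x))) :=
    (hF.comp continuous_snd).mul hact
  have h := continuous_parametric_integral_of_continuous (μ := μ) hunc isCompact_univ
  simpa only [Measure.restrict_univ] using h

/-- ★ **Convexity of `u ↦ ∫ G · κ_u G dμ_{β'}` on `[0, ∞)`** (read through `Real.toNNReal`): continuous and midpoint-convex,
hence convex by Hardy–Littlewood–Pólya's Theorem 86 (`HLP_thm86`). [cite: BakryGentilLedoux2014, Lemma 4.2.6] -/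
theorem convexOn_integral_mul_transition (L : ℕ) [NeZero L] (β' : ℝ)
    (κ : ℝ≥0 → Kernel (GaugeConfig 3 L (Matrix.specialUnitaryGroup (Fin 2) ℂ))
      (GaugeConfig 3 L (Matrix.specialUnitaryGroup (Fin 2) ℂ))) [∀ t, IsMarkovKernel (κ t)]
    (hreal : ∀ (t : ℝ≥0) (x : GaugeConfig 3 L (Matrix.specialUnitaryGroup (Fin 2) ℂ))
        (Ω : Type) [MeasurableSpace Ω] (P : Measure Ω) [IsProbabilityMeasure P]
        (W : ℝ≥0 → Ω → (Edge 3 L × NoiseIdx 2 → ℝ)) (hW : IsFlatBrownian W P)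
        (U : ℝ≥0 → Ω → GaugeConfig 3 L (Matrix.specialUnitaryGroup (Fin 2) ℂ)),
        (∀ ω, U 0 ω = x) →
        (latticeLangevinDynamics (fundamentalLatticeRep 2) β').IsSolution (fundamentalRep (Fin 2))
          hW.natFiltration P W U →
        κ t x = P.map (U t))
    {F : GaugeConfig 3 L (Matrix.specialUnitaryGroup (Fin 2) ℂ) → ℝ} (hF : Continuous F) :
    ConvexOn ℝ (Ici (0 : ℝ)) fun u : ℝ =>
      ∫ x, F x * (∫ y, F y ∂(κ u.toNNReal x)) ∂(wilsonMeasure (d := 3) (L := L) (fundamentalRep (Fin 2)) β') := by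
  have hcont : Continuous fun u : ℝ =>
      ∫ x, F x * (∫ y, F y ∂(κ u.toNNReal x)) ∂(wilsonMeasure (d := 3) (L := L) (fundamentalRep (Fin 2)) β') :=
    (continuous_integral_mul_transition L β' κ hreal hF hF).comp continuous_real_toNNReal
  refine Literature.Analysis.Convex.ChordPointConvexityCriterion.HLP_thm86 (convex_Ici 0) hcont.continuousOn ?_
  intro x hx y hy
  simp only [mem_Ici] at hx hy
  have hx2 : (x / 2).toNNReal + (x / 2).toNNReal = x.toNNReal := by
    rw [← Real.toNNReal_add (by linarith) (by linarith), add_halves]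
  have hy2 : (y / 2).toNNReal + (y / 2).toNNReal = y.toNNReal := by
    rw [← Real.toNNReal_add (by linarith) (by linarith), add_halves]
  have hxy : (x / 2).toNNReal + (y / 2).toNNReal = ((x + y) / 2).toNNReal := by
    rw [← Real.toNNReal_add (by linarith) (by linarith)]; congr 1; ring
  have h := two_mul_integral_mul_transition_add_le L β' κ hreal (x / 2).toNNReal (y / 2).toNNReal hF
  rw [hx2, hy2, hxy] at h
  linarith

/-- **The semigroup Dirichlet form contracts along the semigroup**: `𝓔_h(κ_s G) ≤ 𝓔_h(G)`, i.e.
`∫ (κ_sG)² dμ − ∫ κ_sG · κ_h(κ_sG) dμ ≤ ∫ G² dμ − ∫ G κ_h G dμ` — secant slopes of the convex `Φ_G` over `[2s, 2s+h]` dominate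
those over `[0, h]`. [cite: BakryGentilLedoux2014, Prop. 3.1.6 / (4.2.3)] -/
theorem dirichletScale_transition_le (L : ℕ) [NeZero L] (β' : ℝ)
    (κ : ℝ≥0 → Kernel (GaugeConfig 3 L (Matrix.specialUnitaryGroup (Fin 2) ℂ))
      (GaugeConfig 3 L (Matrix.specialUnitaryGroup (Fin 2) ℂ))) [∀ t, IsMarkovKernel (κ t)]
    (hreal : ∀ (t : ℝ≥0) (x : GaugeConfig 3 L (Matrix.specialUnitaryGroup (Fin 2) ℂ))
        (Ω : Type) [MeasurableSpace Ω] (P : Measure Ω) [IsProbabilityMeasure P]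
        (W : ℝ≥0 → Ω → (Edge 3 L × NoiseIdx 2 → ℝ)) (hW : IsFlatBrownian W P)
        (U : ℝ≥0 → Ω → GaugeConfig 3 L (Matrix.specialUnitaryGroup (Fin 2) ℂ)),
        (∀ ω, U 0 ω = x) →
        (latticeLangevinDynamics (fundamentalLatticeRep 2) β').IsSolution (fundamentalRep (Fin 2))
          hW.natFiltration P W U →
        κ t x = P.map (U t))
    (s h : ℝ≥0) {F : GaugeConfig 3 L (Matrix.specialUnitaryGroup (Fin 2) ℂ) → ℝ} (hF : Continuous F) :
    (∫ x, (∫ y, F y ∂(κ s x)) * (∫ y, F y ∂(κ s x)) ∂(wilsonMeasure (d := 3) (L := L) (fundamentalRep (Fin 2)) β')) -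
        ∫ x, (∫ y, F y ∂(κ s x)) * (∫ y, (∫ z, F z ∂(κ s y)) ∂(κ h x))
          ∂(wilsonMeasure (d := 3) (L := L) (fundamentalRep (Fin 2)) β') ≤
      (∫ x, F x * F x ∂(wilsonMeasure (d := 3) (L := L) (fundamentalRep (Fin 2)) β')) -
        ∫ x, F x * (∫ y, F y ∂(κ h x)) ∂(wilsonMeasure (d := 3) (L := L) (fundamentalRep (Fin 2)) β') := by
  classical
  haveI := secondCountableTopology_su2
  haveI := borelSpace_config L
  set μ : Measure (GaugeConfig 3 L (Matrix.specialUnitaryGroup (Fin 2) ℂ)) :=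
    wilsonMeasure (d := 3) (L := L) (fundamentalRep (Fin 2)) β' with hμ
  set Φ : ℝ → ℝ := fun u => ∫ x, F x * (∫ y, F y ∂(κ u.toNNReal x)) ∂μ with hΦ
  have hconv : ConvexOn ℝ (Ici (0 : ℝ)) Φ := convexOn_integral_mul_transition L β' κ hreal hF
  obtain ⟨M, hM0, hM⟩ := exists_abs_le_of_continuous hF
  have hFi : ∀ (ν : Measure (GaugeConfig 3 L (Matrix.specialUnitaryGroup (Fin 2) ℂ))) [IsProbabilityMeasure ν],
      Integrable F ν := fun ν _ =>
    Integrable.of_bound hF.aestronglyMeasurable M (Eventually.of_forall fun z => by rw [Real.norm_eq_abs]; exact hM z)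
  -- identify the four terms with values of `Φ`
  have hκ0 : κ 0 = Kernel.id := transitionKernel_zero_eq_id L β' κ hreal
  have e0 : ∫ x, F x * F x ∂μ = Φ 0 := by
    simp only [hΦ, Real.toNNReal_zero, hκ0, Kernel.id_apply, integral_dirac]
  have eh : ∫ x, F x * (∫ y, F y ∂(κ h x)) ∂μ = Φ h := by
    simp only [hΦ, Real.toNNReal_coe]
  have e2s : ∫ x, (∫ y, F y ∂(κ s x)) * (∫ y, F y ∂(κ s x)) ∂μ = Φ ((s : ℝ) + s) := by
    have : ((s : ℝ) + s).toNNReal = s + s := by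
      rw [← NNReal.coe_add, Real.toNNReal_coe]
    simp only [hΦ, this]
    exact integral_transition_mul_transition_eq L β' κ hreal s s hF
  have hCK : κ (h + s) = κ s ∘ₖ κ h := chapmanKolmogorov_szz β' κ hreal h s
  have e1 : ∀ x, ∫ y, (∫ z, F z ∂(κ s y)) ∂(κ h x) = ∫ y, F y ∂(κ (h + s) x) := by
    intro x
    haveI : IsProbabilityMeasure ((κ s ∘ₖ κ h) x) := by rw [← hCK]; infer_instance
    rw [hCK]
    exact (Kernel.integral_comp (hFi _)).symm
  have e2sh : ∫ x, (∫ y, F y ∂(κ s x)) * (∫ y, (∫ z, F z ∂(κ s y)) ∂(κ h x)) ∂μ = Φ ((s : ℝ) + s + h) := by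
    have : ((s : ℝ) + s + h).toNNReal = s + (h + s) := by
      rw [← NNReal.coe_add, ← NNReal.coe_add, Real.toNNReal_coe]; ring
    simp only [hΦ, this]
    simp_rw [e1]
    exact integral_transition_mul_transition_eq L β' κ hreal s (h + s) hF
  rw [e0, eh, e2s, e2sh]
  -- secant monotonicity of the convex `Φ`
  rcases eq_or_ne h 0 with hh0 | hh0
  · simp [hh0]
  have hhpos : (0 : ℝ) < h := by
    have : (0 : ℝ≥0) < h := pos_iff_ne_zero.2 hh0
    exact_mod_cast this
  have hs0 : (0 : ℝ) ≤ s := s.2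
  rcases eq_or_lt_of_le hs0 with hs00 | hspos
  · rw [← hs00]; simp
  -- slope over `[0, h]` ≤ slope over `[0, 2s+h]` ≤ slope over `[2s, 2s+h]`
  have h1 := hconv.secant_mono (a := 0) (x := h) (y := (s : ℝ) + s + h)
    (by simp) (by simp only [mem_Ici]; linarith) (by simp only [mem_Ici]; linarith) hhpos.ne'
    (by linarith) (by linarith)
  have h2 := hconv.secant_mono (a := (s : ℝ) + s + h) (x := 0) (y := (s : ℝ) + s)
    (by simp only [mem_Ici]; linarith) (by simp) (by simp only [mem_Ici]; linarith) (by linarith)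
    (by linarith) (by linarith)
  -- normalise the secants
  have e3 : (Φ 0 - Φ ((s : ℝ) + s + h)) / (0 - ((s : ℝ) + s + h)) = (Φ ((s : ℝ) + s + h) - Φ 0) / ((s : ℝ) + s + h) := by
    rw [← neg_sub, ← neg_sub ((s : ℝ) + s + h) 0, sub_zero, neg_div_neg_eq]
  have e4 : (Φ ((s : ℝ) + s) - Φ ((s : ℝ) + s + h)) / ((s : ℝ) + s - ((s : ℝ) + s + h)) =
      (Φ ((s : ℝ) + s + h) - Φ ((s : ℝ) + s)) / h := by
    rw [show (s : ℝ) + s - ((s : ℝ) + s + h) = -(h : ℝ) by ring, ← neg_sub, neg_div_neg_eq]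
  simp only [sub_zero] at h1
  rw [e3, e4] at h2
  have h12 : (Φ h - Φ 0) / h ≤ (Φ ((s : ℝ) + s + h) - Φ ((s : ℝ) + s)) / h := h1.trans h2
  rw [div_le_div_iff_of_pos_right hhpos] at h12
  linarith

/-- **`h ↦ 𝓔_h(G)` increases as `h ↓ 0`**: for `0 < h ≤ h'`, `h'⁻¹(∫G² − ∫Gκ_{h'}G) ≤ h⁻¹(∫G² − ∫Gκ_hG)` (secant slopes of the
convex `Φ_G` from `0`).  So `𝓔(G) := lim_{h↓0} 𝓔_h(G) = sup_h 𝓔_h(G) ∈ [0, ∞]` exists for every continuous `G`.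
[cite: BakryGentilLedoux2014, Remark 4.3.3 (p. 212)] -/
theorem dirichletScale_antitone (L : ℕ) [NeZero L] (β' : ℝ)
    (κ : ℝ≥0 → Kernel (GaugeConfig 3 L (Matrix.specialUnitaryGroup (Fin 2) ℂ))
      (GaugeConfig 3 L (Matrix.specialUnitaryGroup (Fin 2) ℂ))) [∀ t, IsMarkovKernel (κ t)]
    (hreal : ∀ (t : ℝ≥0) (x : GaugeConfig 3 L (Matrix.specialUnitaryGroup (Fin 2) ℂ))
        (Ω : Type) [MeasurableSpace Ω] (P : Measure Ω) [IsProbabilityMeasure P]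
        (W : ℝ≥0 → Ω → (Edge 3 L × NoiseIdx 2 → ℝ)) (hW : IsFlatBrownian W P)
        (U : ℝ≥0 → Ω → GaugeConfig 3 L (Matrix.specialUnitaryGroup (Fin 2) ℂ)),
        (∀ ω, U 0 ω = x) →
        (latticeLangevinDynamics (fundamentalLatticeRep 2) β').IsSolution (fundamentalRep (Fin 2))
          hW.natFiltration P W U →
        κ t x = P.map (U t))
    {h h' : ℝ≥0} (hh : 0 < h) (hhh' : h ≤ h') {F : GaugeConfig 3 L (Matrix.specialUnitaryGroup (Fin 2) ℂ) → ℝ}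
    (hF : Continuous F) :
    (h' : ℝ)⁻¹ * ((∫ x, F x * F x ∂(wilsonMeasure (d := 3) (L := L) (fundamentalRep (Fin 2)) β')) -
        ∫ x, F x * (∫ y, F y ∂(κ h' x)) ∂(wilsonMeasure (d := 3) (L := L) (fundamentalRep (Fin 2)) β')) ≤
      (h : ℝ)⁻¹ * ((∫ x, F x * F x ∂(wilsonMeasure (d := 3) (L := L) (fundamentalRep (Fin 2)) β')) -
        ∫ x, F x * (∫ y, F y ∂(κ h x)) ∂(wilsonMeasure (d := 3) (L := L) (fundamentalRep (Fin 2)) β')) := by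
  classical
  set μ : Measure (GaugeConfig 3 L (Matrix.specialUnitaryGroup (Fin 2) ℂ)) :=
    wilsonMeasure (d := 3) (L := L) (fundamentalRep (Fin 2)) β' with hμ
  set Φ : ℝ → ℝ := fun u => ∫ x, F x * (∫ y, F y ∂(κ u.toNNReal x)) ∂μ with hΦ
  have hconv : ConvexOn ℝ (Ici (0 : ℝ)) Φ := convexOn_integral_mul_transition L β' κ hreal hF
  have hκ0 : κ 0 = Kernel.id := transitionKernel_zero_eq_id L β' κ hreal
  have e0 : ∫ x, F x * F x ∂μ = Φ 0 := by
    simp only [hΦ, Real.toNNReal_zero, hκ0, Kernel.id_apply, integral_dirac]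
  have eh : ∫ x, F x * (∫ y, F y ∂(κ h x)) ∂μ = Φ h := by simp only [hΦ, Real.toNNReal_coe]
  have eh' : ∫ x, F x * (∫ y, F y ∂(κ h' x)) ∂μ = Φ h' := by simp only [hΦ, Real.toNNReal_coe]
  rw [e0, eh, eh']
  have hhR : (0 : ℝ) < h := by exact_mod_cast hh
  have hh'R : (h : ℝ) ≤ h' := by exact_mod_cast hhh'
  have hh'pos : (0 : ℝ) < h' := lt_of_lt_of_le hhR hh'R
  have h1 := hconv.secant_mono (a := 0) (x := h) (y := h')
    (by simp) (by simp only [mem_Ici]; exact hhR.le) (by simp only [mem_Ici]; exact hh'pos.le) hhR.ne' hh'pos.ne' hh'R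
  rw [sub_zero, sub_zero] at h1
  -- `(Φ h − Φ 0)/h ≤ (Φ h' − Φ 0)/h'` ⇒ the claim
  rw [div_le_div_iff₀ hhR hh'pos] at h1
  rw [inv_mul_eq_div, inv_mul_eq_div, div_le_div_iff₀ hh'pos hhR]
  linarith

end Summit.QuantumFields.YangMills.Theorems.ColdStartUniversality

end
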